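import Summits.ABC.ABC.Theses.IneffectiveSubspace
import Summits.ABC.ABC.Theorems.IneffectiveSubspaceDeepRegimeABCCensusDeepTail
import Summits.ABC.ABC.Theorems.IneffectiveSubspaceDeepRegimeABCCensusDeepTailOddA
import Summits.ABC.ABC.Theorems.IneffectiveSubspaceDeepRegimeABCCensusDeepTailOddB
import Literature.NumberTheory.DiophantineGeometry.AbcDepthCensusFast

/-!
# `DeepRegimeABC` (stmt-ABC-15121): certified census of the deep tail, odd decades (C) — the cell `ω₅ ≥ 11` does not meet `c ≤ 10²¹`; `ω₅(abc) ≥ K ⟹ c > 10^(2K-1)` for `8 ≤ K ≤ 14`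

Compute-certificate (line lead `prover-line-stmt-ABC-15121-c2-0`, 2026-08-16; human certificate
objective) for the crux `Summit.ABC.ABC.Theses.IneffectiveSubspace.DeepRegimeABC`, with the fast
soundness-proved enumeration checker
`Literature.NumberTheory.DiophantineGeometry.DepthCensus.checkCellFast` (`AbcDepthCensusFast.lean`,
`depth_lt_of_checkCellFast`).  Third of three files; assembles `…CensusDeepTailOddA.lean` (cells
`8, 9, 12, 13, 14` avoid `c ≤ 10¹⁵, 10¹⁷, 10²³, 10²⁵, 10²⁷`) and `…CensusDeepTailOddB.lean` (cell `10`
avoids `c ≤ 10¹⁹`) with the run of this file into the one-decade sharpening of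
`tenPow_lt_of_le_depth` (`…CensusDeepTail.lean`, lead c1-0: `c > 10^(2K-2)` for `7 ≤ K ≤ 12`).

**Certified here.**  The cell `ω₅ ≥ 11` does not meet the box `c ≤ 10²¹` (`checkCellFast_eleven21`,
2 791 578 depth patterns, not a single lattice candidate; `depth_le_ten_of_le_tenPow21`), and therefore
(`tenPow_lt_of_le_depth_odd`): **an abc triple with `ω₅(abc) ≥ K`, `8 ≤ K ≤ 14`, has `c > 10^(2K-1)`.**
Where the cells actually begin (exact first members `c_K`, `…CensusFirstMembers.lean` for `K ≤ 7`;
`c₈ = 23·1001⁵ ≈ 2.3·10¹⁶` by the C mirror, certificate separate): `log₁₀ c_K ≈ 1.5, 2.4, 3.7, 5.8,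
8.4, 10.6, 12.9, 16.4` for `K = 1, …, 8`.  The decade `10^(2K-1)` is the last one reachable by a single
unchunked run of the fast checker per cell (`≈ 3·10⁶` patterns, `≈ 5` minutes of compiled evaluation);
`K = 7` is exact already (`c₇ = 8458700490625 < 10¹³`).

The only computation trusted to the compiler is the closed `Bool` equation `checkCellFast … = true`
(`native_decide`, computational certificate lane).  Everything else is kernel-checked.
-/

-- `Summit.<Summit>.<Problem>` is the mandated summit-side namespace (CONVENTIONS §2); for the
-- single-conjunct summit `ABC` the two coincide, so the duplicate `ABC.ABC` is deliberate.
set_option linter.dupNamespace false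

namespace Summit.ABC.ABC.Theorems.DeepRegimeABC

open Literature.NumberTheory.DiophantineGeometry
open Literature.NumberTheory.DiophantineGeometry.DepthCensus

/-! ## The compiled run -/

/-- Cell `ω₅ ≥ 11`, box `10²¹` (`15849⁵ > 10²¹`): no lattice candidate. [folklore] -/
theorem checkCellFast_eleven21 :
    checkCellFast (10 ^ 21) 15848 11 (fun _ _ _ => false) = true := by
  native_decide

/-! ## Depth bound in the box -/

/-- **`ω₅(abc) ≤ 10` for every abc triple with `c ≤ 10²¹`.** [folklore] -/
theorem depth_le_ten_of_le_tenPow21 {a b c : ℕ} (habc : IsABCTriple a b c) (hc : c ≤ 10 ^ 21) :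
    ((a * b * c).primeFactors.filter (fun p => 5 ≤ (a * b * c).factorization p)).card ≤ 10 :=
  Nat.le_of_lt_succ (depth_lt_of_checkCellFast (by norm_num) checkCellFast_eleven21 habc hc)

/-! ## Where the deep cells begin, one decade sharper -/

/-- **An abc triple with `ω₅(abc) ≥ K`, `8 ≤ K ≤ 14`, has `c > 10^(2K-1)`** (the cells `ω₅ ≥ 8, …, 14`
do not meet the boxes `10¹⁵, 10¹⁷, 10¹⁹, 10²¹, 10²³, 10²⁵, 10²⁷`). [folklore] -/
theorem tenPow_lt_of_le_depth_odd {a b c K : ℕ} (habc : IsABCTriple a b c) (h8 : 8 ≤ K) (h14 : K ≤ 14)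
    (hK : K ≤ ((a * b * c).primeFactors.filter (fun p => 5 ≤ (a * b * c).factorization p)).card) :
    10 ^ (2 * K - 1) < c := by
  by_contra hle
  rw [not_lt] at hle
  interval_cases K
  · exact absurd (hK.trans (depth_le_seven_of_le_tenPow15 habc hle)) (by norm_num)
  · exact absurd (hK.trans (depth_le_eight_of_le_tenPow17 habc hle)) (by norm_num)
  · exact absurd (hK.trans (depth_le_nine_of_le_tenPow19 habc hle)) (by norm_num)
  · exact absurd (hK.trans (depth_le_ten_of_le_tenPow21 habc hle)) (by norm_num)
  · exact absurd (hK.trans (depth_le_eleven_of_le_tenPow23 habc hle)) (by norm_num)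
  · exact absurd (hK.trans (depth_le_twelve_of_le_tenPow25 habc hle)) (by norm_num)
  · exact absurd (hK.trans (depth_le_thirteen_of_le_tenPow27 habc hle)) (by norm_num)

/-- The two tables together: **`ω₅(abc) ≥ K ⟹ c > 10^(2K-1)` for `8 ≤ K ≤ 14` and `c > 10¹²` for
`K = 7`**, i.e. `c > 10^(2K-2)` throughout `7 ≤ K ≤ 14` with the odd decade gained from `K = 8` on.
[folklore] -/
theorem tenPow_lt_of_le_depth' {a b c K : ℕ} (habc : IsABCTriple a b c) (h7 : 7 ≤ K) (h14 : K ≤ 14)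
    (hK : K ≤ ((a * b * c).primeFactors.filter (fun p => 5 ≤ (a * b * c).factorization p)).card) :
    10 ^ (2 * K - 2) < c := by
  rcases Nat.lt_or_ge K 8 with h | h
  · have hK7 : K = 7 := by omega
    subst hK7
    exact tenPow_lt_of_le_depth habc (by norm_num) (by norm_num) hK
  · calc 10 ^ (2 * K - 2) ≤ 10 ^ (2 * K - 1) := Nat.pow_le_pow_right (by norm_num) (by omega)
      _ < c := tenPow_lt_of_le_depth_odd habc h h14 hK

/-! ## Registered certificate stub of the crux item (stmt-ABC-15121) -/

/-- **Registered certificate `censusDeepTailOddC`** (crux `DeepRegimeABC`, line SketchIdeator5R2, human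
certificate objective): the deep cell `{ω₅ ≥ 11}` contains no abc triple with `c ≤ 10²¹`, and the cell
`{ω₅ ≥ K}`, `8 ≤ K ≤ 14`, lies in `{c > 10^(2K-1)}`. [folklore] -/
theorem censusDeepTailOddC : (∀ a b c : ℕ, Literature.NumberTheory.DiophantineGeometry.IsABCTriple a b c → c ≤ 10 ^ 21 → ((a * b * c).primeFactors.filter (fun p => 5 ≤ (a * b * c).factorization p)).card ≤ 10) ∧ (∀ a b c K : ℕ, Literature.NumberTheory.DiophantineGeometry.IsABCTriple a b c → 8 ≤ K → K ≤ 14 → K ≤ ((a * b * c).primeFactors.filter (fun p => 5 ≤ (a * b * c).factorization p)).card → 10 ^ (2 * K - 1) < c) :=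
  ⟨fun _ _ _ h hc => depth_le_ten_of_le_tenPow21 h hc,
    fun _ _ _ _ h h8 h14 hK => tenPow_lt_of_le_depth_odd h h8 h14 hK⟩

end Summit.ABC.ABC.Theorems.DeepRegimeABC
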